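import Summits.Ventures.HodgeRepro.RouteChain

/-!
# ROUTE.md §2 row «S4 on Prym loci of abelian covers» (L54, LITMAP L4.5), typed as printed: Patel–Zhang 2025 Theorem 1.2

Blind re-derivation cell `pub-hodge-repro`, seat `night-4` (ROUTE HARDENING for the Monday FINAL, gen 2).  Target tree path
`lean/Summits/Ventures/HodgeRepro/Night4PrymLoci.lean`.

ROUTE.md §1 row S4 / §2 L54 / §3.0 list «L4.5 (Prym varieties of étale abelian covers, Patel–Zhang 2025 Thm 1.2 /
Schoen 1988)» among the CLOSED sub-loci of S4.  The held source: Patel–Zhang, *Algebraicity of Hodge classes on some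
generalized Prym Varieties*, arXiv:2506.13729 (2025), store `paper:arxiv-2506.13729` p0003 (read by the seat
2026-08-24T07:54Z).  Setting as printed (Theorem 1.1, p0003:L26–28): «Let `C → C'` be an étale `G`-cover of smooth
projective curves, where the Galois group `G` is a finite abelian group. Let `h = 2g(C') − 2` and suppose `g(C') ≥ 2`»;
the Prym variety (p0003:L46–48): «the finite cover `C → C'` induces the Norm map on Jacobian varieties `J(C) → J(C')`.
A connected component `B` of its kernel is a subabelian variety of `J(C)` and is called the Prym variety»; the Weil
classes (p0003:L59–65): «`H^1(B, ℚ)` is a free `ℚ[G]_nt`-module with rank `h`, and the resulting top exterior power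
`U_Weil := ∧^h_{ℚ[G]_nt} H^1(B, ℚ) ⊂ H^h(B, ℚ)` consists of Hodge classes»; **Theorem 1.2** (p0003:L67–68): «The Hodge
classes `U_Weil` are represented by algebraic cycles.»

Typed over the abstract interface `PrymData` (the Prym data `IsPrymDatum B p` — `B` the Prym variety of such a cover with
`h = 2p`, i.e. `g(C') = p + 1` — and the subspace `prymWeil p B = U_Weil ⊂ H^{2p}(B, ℚ)(p)`, as fields asserting nothing):
`PatelZhang_Thm1_2`, `PrymWeilIsHodge`, and the route's reading `S4_prym_of_PatelZhang`: on a split-Weil `B` whose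
route Weil line `W_F(B)` lies in `U_Weil` (the cell's dictionary clause `WeilLeqPrymWeil`, named as such — the route's
«sub-locus» reading of L4.5), `W_F(B)` is algebraic.  NO open input is closed; HC_CM is NOT proved; nothing here asserts
anything about the original programme.
-/

namespace HodgeRepro.Route

/-- **The interface**: `RouteData` with the Prym data of Patel–Zhang.  `IsPrymDatum B p`: `B` is the Prym variety of an
étale `G`-cover `C → C'` of smooth projective curves with `G` finite abelian and `g(C') = p + 1 ≥ 2` (so `h = 2g(C') − 2
= 2p`); `prymWeil p B`: the subspace `U_Weil = ∧^h_{ℚ[G]_nt} H^1(B, ℚ) ⊂ H^h(B, ℚ)` of p0003:L59–65, placed in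
`H^{2p}(B, ℚ)(p)`.  The fields assert nothing. -/
structure PrymData extends RouteData where
  /-- `B` is the Prym variety of an étale abelian cover with `g(C') = p + 1` -/
  IsPrymDatum : Var → ℕ → Prop
  /-- the Weil classes `U_Weil` of the Prym variety -/
  prymWeil : ∀ (p : ℕ) (B : Var), Submodule ℚ (H p B)

variable (𝓑 : PrymData)

/-- **Patel–Zhang 2025, Theorem 1.2** — store p0003:L67–68, verbatim: «The Hodge classes `U_Weil`
(eqn_intro_Weil-classes) are represented by algebraic cycles.»  PRINTED (2025 preprint; proof sketch p0003:L70–72: «the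
same chain of maps, together with Theorem (thm:mainthm1) and the standard conjecture on abelian varieties [Kleiman]»). -/
def PatelZhang_Thm1_2 : Prop :=
  ∀ (p : ℕ) (B : 𝓑.Var), 𝓑.IsPrymDatum B p → 𝓑.prymWeil p B ≤ 𝓑.alg p B

/-- **`U_Weil` consists of Hodge classes** — store p0003:L61–65: «the resulting top exterior power `U_Weil := ∧^h_{ℚ[G]_nt}
H^1(B, ℚ) ⊂ H^h(B, ℚ)` consists of Hodge classes (see Section (sec_prelim) for the proof of these statements)».
PRINTED. -/
def PrymWeilIsHodge : Prop :=
  ∀ (p : ℕ) (B : 𝓑.Var), 𝓑.IsPrymDatum B p → 𝓑.prymWeil p B ≤ 𝓑.hodge p B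

/-- **The route's sub-locus reading of L4.5** — the cell's dictionary clause: when a split-Weil corner product `B`
(relative to `F`) is the Prym variety of an étale abelian cover and the route's Weil line `W_F(B) = ∧^{2p}_F H^1(B, ℚ)`
lies inside Patel–Zhang's `U_Weil = ∧^{2p}_{ℚ[G]_nt} H^1(B, ℚ)` (`F` acting through `ℚ[G]_nt`).  UNPRINTED (the cell's;
it delimits the sub-locus on which L4.5 applies). -/
def WeilLeqPrymWeil : Prop :=
  ∀ (p : ℕ) (B : 𝓑.Var), 𝓑.SplitWeil p B → 𝓑.IsPrymDatum B p → 𝓑.weil p B ≤ 𝓑.prymWeil p B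

/-- **S4 on the Prym sub-locus** (ROUTE.md §2 L54): for every split-Weil `B` that is such a Prym variety with
`W_F(B) ⊆ U_Weil`, the Weil line `W_F(B)` is algebraic (Patel–Zhang Theorem 1.2). -/
theorem S4_prym_of_PatelZhang (hPZ : PatelZhang_Thm1_2 𝓑) (hD : WeilLeqPrymWeil 𝓑) (p : ℕ) (B : 𝓑.Var)
    (hB : 𝓑.SplitWeil p B) (hP : 𝓑.IsPrymDatum B p) : 𝓑.weil p B ≤ 𝓑.alg p B :=
  (hD p B hB hP).trans (hPZ p B hP)

/-- **The Prym Weil classes are Hodge classes that are algebraic** — the two printed statements together, on every Prym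
datum. -/
theorem prymWeil_le_hodge_inf_alg (hPZ : PatelZhang_Thm1_2 𝓑) (hH : PrymWeilIsHodge 𝓑) (p : ℕ) (B : 𝓑.Var)
    (hP : 𝓑.IsPrymDatum B p) : 𝓑.prymWeil p B ≤ 𝓑.hodge p B ⊓ 𝓑.alg p B :=
  le_inf (hH p B hP) (hPZ p B hP)

end HodgeRepro.Route
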